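import Literature.RingTheory.Binomial.ChooseDivNatCast
import Literature.Analysis.Complex.LogDerivZeros
import Literature.NumberTheory.Automorphic.ModularLambdaQExpansion
import HarnessLib

/-!
# `λ/16` as a function of the nome, and the `N`-th root `(λ(zᴺ)/16)^{1/N}` on the unit disc

Third file on the modular `λ`-function (`ModularLambda.lean`: `λ = θ₂⁴/θ₃⁴`;
`ModularLambdaQExpansion.lean`: `qExpansion 2 (λ/16) = L ∈ X − 8X² + X³ℤ⟦X⟧`). Here `λ/16` is
viewed, as in Calegari–Dimitrov–Tang (F. Calegari, V. Dimitrov, Y. Tang, *The unbounded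
denominators conjecture*, J. Amer. Math. Soc. **38** (2025), arXiv:2109.09040), as a holomorphic
function of the nome `q = e^{πiτ}` on the unit disc — Mathlib's cusp function
`Λ(q) := cuspFunction 2 (λ/16) q`, so that `Λ(e^{πiτ}) = λ(τ)/16` — and we prove the analytic
half of the sentence in the proof of op. cit. Lemma 23 (arXiv v1 numbering; §4.2):

> "`ᴺ√(λ(zᴺ)/16) : D(0,1) → ℂ ∖ 16^{-1/N} μ_N` is a well-defined holomorphic map with derivative
> being `1` at `0`"

(whence, by the Schwarz lemma for the universal covering, the conformal radius of
`ℂ ∖ 16^{-1/N}μ_N` exceeds `1` — the input of CDT's Corollary 5 / Lemma 23 finiteness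
`[R_N : ℚ(λ)] < ∞`), together with its formal half, the display (xt) of op. cit. §3 (proof of
Proposition 15): `x(t) := (λ/16)^{1/N} ∈ t + t² ℤ[1/N]⟦t⟧`, `x(t)ᴺ = (λ/16)(tᴺ)`.

## Main results (all proved; no definitions, no named facts)

* `cuspFunction_modularLambda_qParam` / `_exp` — `Λ(e^{πiτ}) = λ(τ)/16`;
  `differentiableOn_cuspFunction_modularLambda` — `Λ` is holomorphic on `D(0,1)`;
  `cuspFunction_modularLambda_zero`, `deriv_cuspFunction_modularLambda_zero` — `Λ(0) = 0`,
  `Λ'(0) = 1`; `hasSum_cuspFunction_modularLambda` — `Λ(q) = Σ Lₘ qᵐ` on the disc;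
  `cuspFunction_modularLambda_ne_zero`, `cuspFunction_modularLambda_ne_one_div_sixteen` —
  `Λ(q) ∉ {0, 1/16}` for `0 < |q| < 1` (`λ ≠ 0, 1` on `ℍ`).
* **`exists_root_cuspFunction_modularLambda`** — for `N ≥ 1` a holomorphic `Φ` on `D(0,1)` with
  `Φ(0) = 0`, `Φ'(0) = 1`, `Φ(z)ᴺ = Λ(zᴺ)` and `Φ(z)ᴺ ≠ 1/16` (i.e.
  `Φ : D(0,1) → ℂ ∖ 16^{-1/N}μ_N`);
  `exists_root_modularLambda_div_sixteen` — the same with `Φ(e^{πiτ/N})ᴺ = λ(τ)/16`.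
* `exists_formal_root_qExpansion_modularLambda` — display (xt): a power series
  `x ∈ t + t²ℤ[1/N]⟦t⟧` with `xᴺ = L(tᴺ)`, `L = qExpansion 2 (λ/16) ∈ ℤ⟦X⟧`.

## Proof sketch

Mathlib's `q`-expansion API at period `2` applies to `λ/16` (periodic, holomorphic, `→ 0` at
`i∞`: `ModularLambdaQExpansion.lean`), giving holomorphy of `Λ` on the disc, `Λ(0) = 0` and
`Λ'(0) = coeff 1 L = 1`. For `q ≠ 0`, `Λ(q) = λ(τ)/16` with `τ = invQParam 2 q ∈ ℍ`, so
`Λ(q) ≠ 0, 1/16`. The `N`-th root: `u := dslope Λ 0` (`= Λ(q)/q`, `u(0) = 1`) is holomorphic and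
zero-free on the disc, hence so is `z ↦ u(zᴺ)`, which therefore has a holomorphic logarithm `φ`
with `φ(0) = 0` (`Literature.Analysis.Complex.exists_log_on_ball`); put `Φ(z) := z e^{φ(z)/N}`.
The formal root is `Literature.RingTheory.Binomial.exists_root_series_of_mem_X_add_X_sq` (Kummer:
`C(1/N, k) ∈ ℤ[1/N]`) applied to `L = X(1 + X y)`.

## References

* [CalegariDimitrovTang2025] F. Calegari, V. Dimitrov, Y. Tang, The unbounded denominators
  conjecture, J. Amer. Math. Soc. 38 (2025), 627–702; arXiv:2109.09040: §1 p. 3 (`λ/16 = q − 8q²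
  + ⋯`), §3 proof of Proposition 15 (display (xt)), §4.2 proof of Lemma 23 (the map
  `ᴺ√(λ(zᴺ)/16)`), §5.3 (`λ(q) = 16q − 128q² + ⋯` as a function on the disc).
-/

noncomputable section

open Complex Real Filter Topology Function Metric Set
open UpperHalfPlane hiding I
open scoped Real Topology Manifold

namespace Literature.NumberTheory.Automorphic

namespace ModularLambda

open Literature.NumberTheory.EllipticCurves.JacobiThetaNull

/- Throughout, `Λ₁₆` in the prose stands for Mathlib's cusp function at period `2` of `λ/16`,
`cuspFunction 2 (fun τ : ℍ ↦ modularLambda τ / 16)` — the holomorphic function of the nome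
`q = e^{πiτ}` with `Λ₁₆ (e^{πiτ}) = λ(τ)/16`, extended to `q = 0` by its limit (written out in full
in the statements: no notation or definition is introduced). -/

/-! ### `λ/16` satisfies the hypotheses of Mathlib's `q`-expansion API at period `2` -/

/-- `λ/16` is `2`-periodic in Mathlib's sense. [folklore] -/
theorem periodic_modularLambda_div_sixteen :
    Periodic ((fun τ : ℍ ↦ modularLambda τ / 16) ∘ ofComplex) (2 : ℝ) :=
  periodic_comp_ofComplex_two (g := fun z ↦ modularLambda z / 16) fun z _ ↦ by
    rw [modularLambda_add_two]

/-- `λ/16` is holomorphic on `ℍ` (as an `MDifferentiable` function on the manifold `ℍ`).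
[folklore] -/
theorem mdifferentiable_modularLambda_div_sixteen : MDiff (fun τ : ℍ ↦ modularLambda τ / 16) :=
  mdifferentiable_of_differentiableAt (g := fun z ↦ modularLambda z / 16) fun _ hz ↦
    (differentiableAt_modularLambda hz).div_const 16

/-- `λ/16 → 0` at `i∞`. [folklore] -/
theorem isZeroAtImInfty_modularLambda_div_sixteen :
    IsZeroAtImInfty (fun τ : ℍ ↦ modularLambda τ / 16) := by
  have h := (tendsto_modularLambda.div_const 16).comp tendsto_coe_atImInfty
  rw [zero_div] at h
  exact h

/-- `λ/16` is bounded at `i∞`. [folklore] -/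
theorem isBoundedAtImInfty_modularLambda_div_sixteen :
    IsBoundedAtImInfty (fun τ : ℍ ↦ modularLambda τ / 16) :=
  isBoundedAtImInfty_of_tendsto (g := fun z ↦ modularLambda z / 16)
    (tendsto_modularLambda.div_const 16)

/-! ### `Λ₁₆`: `λ/16` as a holomorphic function of the nome on the unit disc -/

/-- `Λ₁₆(𝕢₂(τ)) = λ(τ)/16` for `τ ∈ ℍ`. [folklore] -/
theorem cuspFunction_modularLambda_qParam (τ : ℍ) :
    (cuspFunction 2 (fun τ : ℍ ↦ modularLambda τ / 16)) (Periodic.qParam 2 τ) =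
      modularLambda τ / 16 :=
  eq_cuspFunction τ two_ne_zero periodic_modularLambda_div_sixteen

/-- `Λ₁₆(e^{πiτ}) = λ(τ)/16` for `Im τ > 0` ("`λ(q)`", [cite: CalegariDimitrovTang2025, §5.3]). -/
theorem cuspFunction_modularLambda_exp {τ : ℂ} (hτ : 0 < im τ) :
    (cuspFunction 2 (fun τ : ℍ ↦ modularLambda τ / 16)) (cexp (π * I * τ)) =
      modularLambda τ / 16 := by
  rw [← qParam_two]
  exact cuspFunction_modularLambda_qParam ⟨τ, hτ⟩

/-- For `0 < |q| < 1`: `q = e^{πiτ}` for some `τ ∈ ℍ`, and `Λ₁₆(q) = λ(τ)/16`. [folklore] -/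
theorem exists_cuspFunction_modularLambda_eq {q : ℂ} (hq : ‖q‖ < 1) (hq0 : q ≠ 0) :
    ∃ τ : ℂ, 0 < im τ ∧ cexp (π * I * τ) = q ∧
      (cuspFunction 2 (fun τ : ℍ ↦ modularLambda τ / 16)) q = modularLambda τ / 16 := by
  have him : 0 < im (Periodic.invQParam 2 q) :=
    Periodic.im_invQParam_pos_of_norm_lt_one two_pos hq hq0
  refine ⟨Periodic.invQParam 2 q, him, ?_, ?_⟩
  · rw [← qParam_two]
    exact Periodic.qParam_right_inv two_ne_zero hq0
  · rw [cuspFunction, Periodic.cuspFunction_eq_of_nonzero _ _ hq0, comp_apply,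
      ofComplex_apply_of_im_pos him]

/-- `Λ₁₆(q) ≠ 0` for `0 < |q| < 1` (`λ ≠ 0` on `ℍ`). [folklore] -/
theorem cuspFunction_modularLambda_ne_zero {q : ℂ} (hq : ‖q‖ < 1) (hq0 : q ≠ 0) :
    (cuspFunction 2 (fun τ : ℍ ↦ modularLambda τ / 16)) q ≠ 0 := by
  obtain ⟨τ, hτ, -, h⟩ := exists_cuspFunction_modularLambda_eq hq hq0
  rw [h]
  exact div_ne_zero (modularLambda_ne_zero hτ) (by norm_num)

/-- `Λ₁₆` is holomorphic on the unit disc. [folklore] -/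
theorem differentiableOn_cuspFunction_modularLambda :
    DifferentiableOn ℂ (cuspFunction 2 (fun τ : ℍ ↦ modularLambda τ / 16)) (ball 0 1) :=
  differentiableOn_cuspFunction_ball two_pos periodic_modularLambda_div_sixteen
    mdifferentiable_modularLambda_div_sixteen isBoundedAtImInfty_modularLambda_div_sixteen

/-- `Λ₁₆(0) = 0` (`λ → 0` at `i∞`). [folklore] -/
theorem cuspFunction_modularLambda_zero :
    (cuspFunction 2 (fun τ : ℍ ↦ modularLambda τ / 16)) 0 = 0 :=
  isZeroAtImInfty_modularLambda_div_sixteen.cuspFunction_apply_zero two_pos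

/-- `Λ₁₆(q) ≠ 1/16` on the unit disc (`λ ≠ 1` on `ℍ`, and `Λ₁₆(0) = 0`). [folklore] -/
theorem cuspFunction_modularLambda_ne_one_div_sixteen {q : ℂ} (hq : ‖q‖ < 1) :
    (cuspFunction 2 (fun τ : ℍ ↦ modularLambda τ / 16)) q ≠ 1 / 16 := by
  rcases eq_or_ne q 0 with rfl | hq0
  · rw [cuspFunction_modularLambda_zero]
    norm_num
  · obtain ⟨τ, hτ, -, h⟩ := exists_cuspFunction_modularLambda_eq hq hq0
    rw [h]
    intro h1
    exact modularLambda_ne_one hτ (by linear_combination 16 * h1)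

/-- **`Λ₁₆(q) = Σₘ Lₘ qᵐ` on the unit disc**, `L = qExpansion 2 (λ/16)`. [folklore] -/
theorem hasSum_cuspFunction_modularLambda {q : ℂ} (hq : ‖q‖ < 1) :
    HasSum (fun m : ℕ ↦ (qExpansion 2 (fun τ : ℍ ↦ modularLambda τ / 16)).coeff m * q ^ m)
      ((cuspFunction 2 (fun τ : ℍ ↦ modularLambda τ / 16)) q) := by
  simpa only [smul_eq_mul] using hasSum_qExpansion_of_norm_lt two_pos
    periodic_modularLambda_div_sixteen mdifferentiable_modularLambda_div_sixteen
    isBoundedAtImInfty_modularLambda_div_sixteen hq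

/-- **`λ(q)/16 = q − 8q² + ⋯` on the whole unit disc with integer coefficients**: there is
`L ∈ ℤ⟦X⟧`, `coeff 0 L = 0`, `coeff 1 L = 1`, `coeff 2 L = −8`, with `Λ₁₆(q) = Σₘ Lₘ qᵐ` for all
`|q| < 1`. [cite: CalegariDimitrovTang2025, §1 p. 3 and §5.3] -/
theorem exists_hasSum_int_cuspFunction_modularLambda :
    ∃ L : PowerSeries ℤ, PowerSeries.coeff 0 L = 0 ∧ PowerSeries.coeff 1 L = 1 ∧
      PowerSeries.coeff 2 L = -8 ∧
      ∀ q : ℂ, ‖q‖ < 1 →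
        HasSum (fun m : ℕ ↦ ((PowerSeries.coeff m L : ℤ) : ℂ) * q ^ m)
          ((cuspFunction 2 (fun τ : ℍ ↦ modularLambda τ / 16)) q) := by
  obtain ⟨L, hL0, hL1, hL2, hL⟩ := exists_qExpansion_modularLambda_div_sixteen_eq_map
  refine ⟨L, hL0, hL1, hL2, fun q hq ↦ ?_⟩
  have h := hasSum_cuspFunction_modularLambda hq
  rw [hL] at h
  simpa only [PowerSeries.coeff_map, eq_intCast] using h

/-- `Λ₁₆'(0) = 1` (the coefficient of `q` in `λ/16 = q − 8q² + ⋯`). [folklore] -/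
theorem deriv_cuspFunction_modularLambda_zero :
    deriv (cuspFunction 2 (fun τ : ℍ ↦ modularLambda τ / 16)) 0 = 1 := by
  obtain ⟨L, -, hL1, -, hL⟩ := exists_qExpansion_modularLambda_div_sixteen_eq_map
  have h := qExpansion_coeff (h := 2) (fun τ : ℍ ↦ modularLambda τ / 16) 1
  rw [hL, PowerSeries.coeff_map, hL1, map_one, Nat.factorial_one, Nat.cast_one, inv_one, one_mul,
    iteratedDeriv_one] at h
  exact h.symm

/-! ### The holomorphic `N`-th root `(λ(zᴺ)/16)^{1/N}` on the unit disc -/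

/-- **The map `ᴺ√(λ(zᴺ)/16)` of Calegari–Dimitrov–Tang.** For every `N ≥ 1` there is a function
`Φ`, holomorphic on the unit disc, with `Φ(0) = 0`, `Φ'(0) = 1`, `Φ(z)ᴺ = Λ₁₆(zᴺ)` for `|z| < 1`,
and `Φ(z)ᴺ ≠ 1/16` for `|z| < 1` — that is, `Φ` is a holomorphic map
`D(0,1) → ℂ ∖ 16^{-1/N}μ_N` with derivative `1` at `0`.
[cite: CalegariDimitrovTang2025, proof of Lemma 23 (arXiv v1 numbering; §4.2)] -/
theorem exists_root_cuspFunction_modularLambda {N : ℕ} (hN : 0 < N) :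
    ∃ Φ : ℂ → ℂ, DifferentiableOn ℂ Φ (ball 0 1) ∧ Φ 0 = 0 ∧ deriv Φ 0 = 1 ∧
      (∀ z ∈ ball (0 : ℂ) 1,
        Φ z ^ N = (cuspFunction 2 (fun τ : ℍ ↦ modularLambda τ / 16)) (z ^ N)) ∧
      ∀ z ∈ ball (0 : ℂ) 1, Φ z ^ N ≠ 1 / 16 := by
  have hN0 : N ≠ 0 := hN.ne'
  -- `u := dslope Λ₁₆ 0`: holomorphic on the disc, `u 0 = 1`, `u q = Λ₁₆ q / q`, zero-free
  set u : ℂ → ℂ := dslope (cuspFunction 2 (fun τ : ℍ ↦ modularLambda τ / 16)) 0 with hu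
  have hud : DifferentiableOn ℂ u (ball 0 1) :=
    (Complex.differentiableOn_dslope (ball_mem_nhds (0 : ℂ) one_pos)).mpr
      differentiableOn_cuspFunction_modularLambda
  have hu0 : u 0 = 1 := by rw [hu, dslope_same, deriv_cuspFunction_modularLambda_zero]
  have hune : ∀ q : ℂ, q ≠ 0 → u q = (cuspFunction 2 (fun τ : ℍ ↦ modularLambda τ / 16)) q / q := by
    intro q hq0
    rw [hu, dslope_of_ne _ hq0, slope_def_field, cuspFunction_modularLambda_zero, sub_zero,
      sub_zero]
  have hu_ne : ∀ q ∈ ball (0 : ℂ) 1, u q ≠ 0 := by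
    intro q hq
    rcases eq_or_ne q 0 with rfl | hq0
    · rw [hu0]
      exact one_ne_zero
    · rw [hune q hq0]
      exact div_ne_zero (cuspFunction_modularLambda_ne_zero (mem_ball_zero_iff.mp hq) hq0) hq0
  -- `z ↦ u (z ^ N)` is holomorphic and zero-free on the disc, hence has a logarithm
  have hpowball : ∀ z ∈ ball (0 : ℂ) 1, z ^ N ∈ ball (0 : ℂ) 1 := by
    intro z hz
    rw [mem_ball_zero_iff] at hz ⊢
    rw [norm_pow]
    exact pow_lt_one₀ (norm_nonneg _) hz hN0
  have hgd : DifferentiableOn ℂ (fun z ↦ u (z ^ N)) (ball 0 1) :=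
    hud.comp (differentiableOn_pow N) fun z hz ↦ hpowball z hz
  have hg0 : ∀ z ∈ ball (0 : ℂ) 1, u (z ^ N) ≠ 0 := fun z hz ↦ hu_ne _ (hpowball z hz)
  obtain ⟨φ, hφd, hφ0, -, hφ⟩ := Literature.Analysis.Complex.exists_log_on_ball hgd hg0
  have hφ' : ∀ z ∈ ball (0 : ℂ) 1, u (z ^ N) = cexp (φ z) := by
    intro z hz
    have h := hφ z hz
    rwa [zero_pow hN0, hu0, one_mul] at h
  -- `Φ z := z · exp (φ z / N)`
  have hroot : ∀ z ∈ ball (0 : ℂ) 1,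
      (z * cexp (φ z / N)) ^ N = (cuspFunction 2 (fun τ : ℍ ↦ modularLambda τ / 16)) (z ^ N) := by
    intro z hz
    rw [mul_pow, ← Complex.exp_nat_mul, mul_div_cancel₀ _ (Nat.cast_ne_zero.mpr hN0), ← hφ' z hz]
    rcases eq_or_ne z 0 with rfl | hz0
    · rw [zero_pow hN0, zero_mul, cuspFunction_modularLambda_zero]
    · rw [hune _ (pow_ne_zero N hz0), mul_div_cancel₀ _ (pow_ne_zero N hz0)]
  have hφat : DifferentiableAt ℂ φ 0 := hφd.differentiableAt (ball_mem_nhds (0 : ℂ) one_pos)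
  refine ⟨fun z ↦ z * cexp (φ z / N), differentiableOn_id.mul (hφd.div_const _).cexp,
    by simp, ?_, hroot, fun z hz ↦ ?_⟩
  · have h1 : HasDerivAt (fun z ↦ cexp (φ z / N)) (cexp (φ 0 / N) * (deriv φ 0 / N)) 0 :=
      (hφat.hasDerivAt.div_const (N : ℂ)).cexp
    have h2 := (hasDerivAt_id (0 : ℂ)).mul h1
    simp only [id_eq, zero_mul, add_zero, one_mul, hφ0, zero_div, Complex.exp_zero] at h2
    exact h2.deriv
  · rw [hroot z hz]
    exact cuspFunction_modularLambda_ne_one_div_sixteen (mem_ball_zero_iff.mp (hpowball z hz))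

/-- **`(λ/16)^{1/N}` as a holomorphic function of `t = e^{πiτ/N}`.** For `N ≥ 1` there is `Φ`
holomorphic on the unit disc with `Φ(0) = 0`, `Φ'(0) = 1`, `Φ(D(0,1)) ⊆ ℂ ∖ 16^{-1/N}μ_N`, and
`Φ(e^{πiτ/N})ᴺ = λ(τ)/16` for every `τ` with `Im τ > 0`.
[cite: CalegariDimitrovTang2025, proof of Lemma 23 and §3 display (xt) (arXiv v1 numbering)] -/
theorem exists_root_modularLambda_div_sixteen {N : ℕ} (hN : 0 < N) :
    ∃ Φ : ℂ → ℂ, DifferentiableOn ℂ Φ (ball 0 1) ∧ Φ 0 = 0 ∧ deriv Φ 0 = 1 ∧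
      (∀ z ∈ ball (0 : ℂ) 1, Φ z ^ N ≠ 1 / 16) ∧
      ∀ τ : ℂ, 0 < im τ → Φ (cexp (π * I * τ / N)) ^ N = modularLambda τ / 16 := by
  obtain ⟨Φ, hd, h0, h1, hroot, hne⟩ := exists_root_cuspFunction_modularLambda hN
  refine ⟨Φ, hd, h0, h1, hne, fun τ hτ ↦ ?_⟩
  have hpow : cexp (π * I * τ / N) ^ N = cexp (π * I * τ) := by
    rw [← Complex.exp_nat_mul, mul_div_cancel₀ _ (Nat.cast_ne_zero.mpr hN.ne')]
  have hball : cexp (π * I * τ / N) ∈ ball (0 : ℂ) 1 := by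
    rw [mem_ball_zero_iff]
    have h : ‖cexp (π * I * τ / N)‖ ^ N < 1 := by
      rw [← norm_pow, hpow, ← qParam_two]
      exact Periodic.norm_qParam_lt_one two_pos hτ
    contrapose! h
    exact one_le_pow₀ h
  rw [hroot _ hball, hpow, cuspFunction_modularLambda_exp hτ]

/-! ### The formal `N`-th root: CDT's display (xt) -/

/-- **`x(t) := (λ/16)^{1/N} ∈ t + t² ℤ[1/N]⟦t⟧`** [cite: CalegariDimitrovTang2025, §3, proof of
Proposition 15, display (xt)]: with `L = qExpansion 2 (λ/16) ∈ ℤ⟦X⟧` (so `λ/16 = L(q)`,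
`q = e^{πiτ} = tᴺ`), there is a power series `x ∈ ℚ⟦t⟧` whose coefficients lie in `ℤ[1/N]`
(each is `z/Nᵐ`), with `x ≡ t (mod t²)` and `xᴺ = L(tᴺ)` (the Kummer integrality
`C(1/N, k) ∈ ℤ[1/N]` of `Literature/RingTheory/Binomial/ChooseDivNatCast.lean`). -/
theorem exists_formal_root_qExpansion_modularLambda {N : ℕ} (hN : N ≠ 0) :
    ∃ (L : PowerSeries ℤ) (x : PowerSeries ℚ),
      qExpansion 2 (fun τ : ℍ ↦ modularLambda τ / 16) = L.map (Int.castRingHom ℂ) ∧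
      (∀ n : ℕ, ∃ (m : ℕ) (z : ℤ), PowerSeries.coeff n x = z / (N : ℚ) ^ m) ∧
      PowerSeries.constantCoeff x = 0 ∧ PowerSeries.coeff 1 x = 1 ∧
      x ^ N = PowerSeries.expand N hN (L.map (Int.castRingHom ℚ)) := by
  obtain ⟨L, hL0, hL1, -, hL⟩ := exists_qExpansion_modularLambda_div_sixteen_eq_map
  -- `L = X (1 + X y)` with `y = Σ L_{n+2} Xⁿ`
  set y : PowerSeries ℤ := PowerSeries.mk fun n ↦ PowerSeries.coeff (n + 2) L with hy
  have hLy : L = PowerSeries.X * (1 + PowerSeries.X * y) := by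
    ext n
    rcases n with _ | n
    · rw [PowerSeries.coeff_zero_X_mul, hL0]
    · rw [PowerSeries.coeff_succ_X_mul, map_add, PowerSeries.coeff_one]
      rcases n with _ | n
      · rw [if_pos rfl, PowerSeries.coeff_zero_X_mul, add_zero, hL1]
      · rw [if_neg (Nat.succ_ne_zero n), zero_add, PowerSeries.coeff_succ_X_mul, hy,
          PowerSeries.coeff_mk]
  obtain ⟨x, hxc, hx0, hx1, hxN⟩ :=
    Literature.RingTheory.Binomial.exists_root_series_of_mem_X_add_X_sq hN y
  refine ⟨L, x, hL, hxc, hx0, hx1, ?_⟩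
  rw [hxN, hLy]
  simp only [map_mul, map_add, map_one, PowerSeries.map_X, PowerSeries.expand_X]

end ModularLambda

end Literature.NumberTheory.Automorphic

end
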